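import Mathlib

/-!
# Beta / MultiscalePartitionProduct — NODE (w4-a′), FIRST PIECE: THE PRODUCT OF A LAYER PARTITION OF UNITY WITH PER-LAYER
# EXACT PARTITIONS IS AN EXACT PARTITION OF UNITY, WITH PRODUCT RULES FOR FIRST AND SECOND DIFFERENCES (MODEL; generic
# finite bookkeeping — the DESIGN of the scale-adapted partition recorded in the O.2 skeleton §8.10)

The scale-adapted partition of unity that node (w4-b′)/(w4-c′) (`MultiscaleParametrixTorus.parametrix_torus_adapted`) takes as
DATA is to be built as `h_{(j,z)} := ψ_j · φ_{j,z}`: a LAYER partition `ψ_j` (`Σ_j ψ_j² = 1`, `ψ_j` living where the cells have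
scale `≍ S_j`) times, for each layer `j`, an EXACT partition `φ_{j,·}` at scale `M·S_j` (on the torus: b05's `hSU` at scale
`M·S_j`, `B5SmoothPartition.sum_hSU_sq`).  This module proves the generic facts of that design:
* `prodFam ψ φ ⟨j, z⟩ = ψ_j · φ_{j,z}` and **`sum_sq_prodFam`**: `Σ_{(j,z)} h_{(j,z)}² = 1` EXACTLY (no normalisation of the cube
  factor), `abs_prodFam_le_one`, `prodFam_ne_zero` (supports multiply);
* the product rules: **`abs_sub_mul_le`** `|f(y)g(y) − f(x)g(x)| ≤ |f(y)|·|g(y) − g(x)| + |g(x)|·|f(y) − f(x)|` and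
  **`secondDiff_mul_eq`** `δ²(fg) = f⁺·δ²g + g·δ²f + (g − g⁻)(f⁺ − f⁻)` with the bound **`abs_secondDiff_mul_le`**
  `|δ²(fg)| ≤ F·G₂ + G·F₂ + 2F₁G₁` for `|f| ≤ F`, `|g| ≤ G`, first differences `≤ F₁, G₁`, second differences `≤ F₂, G₂` —
  so scale-adapted factors (`F₁, G₁ ≍ 1/(M S)`, `F₂, G₂ ≍ 1/(MS)²`) give scale-adapted products;
* **`prodFam_bounds`**: the family-level packaging (`|h| ≤ 1`, first differences `≤ G₁ + F₁`, second differences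
  `≤ G₂ + F₂ + 2F₁G₁` for the index at hand from the bounds of its two factors).
What remains of (w4-a′) after this module: the layer partition `ψ_j` on a concrete graded cell family (smoothed layer indicators,
normalised by gen-8/gen-9 `puNorm` calculus with `k ≤ 2` active layers) and the hull geometry (overlap `ν`, hull scale `≤ L·S_j`)
(unit `b2b-balaban-beta-d4-p2`, GEN 9, MODEL crew; O.2 skeleton v1.5.0 §8.10 (w4-a′) DESIGN).

HONEST FRAMING: discharging `BetaPertH` makes Bałaban's UV stability UNCONDITIONAL — NOT the continuum limit, NOT the
Clay problem.  HONEST DEPENDENCY (verbatim): «continuum YM on T⁴ ⇐ BetaPertH ∧ nine spine estimates (0/9 proved);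
BetaPertH ⇐ (D1) ∧ (D4) ∧ CAP+tail; G-an2-4 gates asym, D1 and NE2/3/4.»  THIS MODULE DISCHARGES NOTHING of `BetaPertH`,
asserts NOTHING printed and cites nothing as a fact (ABSOLUTE RULE): [folklore] algebra of finite sums and absolute values; the
factors are DATA.  LOCI (shape only): [B5] = `Balaban1984PropagatorsI` (1.118) p. 37; [B6] = `Balaban1984PropagatorsII` (2.36)
p. 229 («Taking these covers for all j from 0 to k we get a family 𝒟 of cubes □ of different sizes … We construct also the
corresponding family of functions h_□»).  No class change on row D4 (critical-path width 0; D4 DISCHARGE NO DATE); NOT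
BetaPertH, NOT continuum, NOT Clay, NOT summit progress.
-/

namespace Summit.QuantumFields.BalabanUV.Beta.MultiscalePartitionProduct

open Finset

noncomputable section

/-! ## §1 The product family and its exact normalisation -/

section Family

variable {X J : Type} {ι : J → Type}

/-- MODEL: **the product family** `h_{(j,z)}(x) = ψ_j(x)·φ_{j,z}(x)` indexed by the pairs (layer, cube of that layer).
[cite: Balaban1984PropagatorsII, (2.36) p.229] -/
def prodFam (ψ : J → X → ℝ) (φ : (j : J) → ι j → X → ℝ) (p : Σ j, ι j) (x : X) : ℝ := ψ p.1 x * φ p.1 p.2 x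

/-- Unfolding. [folklore] -/
@[simp] theorem prodFam_apply (ψ : J → X → ℝ) (φ : (j : J) → ι j → X → ℝ) (j : J) (z : ι j) (x : X) :
    prodFam ψ φ ⟨j, z⟩ x = ψ j x * φ j z x := rfl

/-- **EXACT PARTITION OF UNITY**: `Σ_j ψ_j(x)² = 1` and `Σ_z φ_{j,z}(x)² = 1` for every layer `j` with `ψ_j(x) ≠ 0` ⟹
`Σ_{(j,z)} h_{(j,z)}(x)² = 1`. [cite: Balaban1984PropagatorsI, (1.118) p.37; Balaban1984PropagatorsII, (2.36) p.229] -/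
theorem sum_sq_prodFam [Fintype J] [∀ j, Fintype (ι j)] (ψ : J → X → ℝ) (φ : (j : J) → ι j → X → ℝ) (x : X)
    (hψ : ∑ j, ψ j x ^ 2 = 1) (hφ : ∀ j, ψ j x ≠ 0 → ∑ z, φ j z x ^ 2 = 1) :
    ∑ p : Σ j, ι j, prodFam ψ φ p x ^ 2 = 1 := by
  classical
  rw [← Finset.univ_sigma_univ, Finset.sum_sigma]
  calc ∑ j, ∑ z : ι j, prodFam ψ φ ⟨j, z⟩ x ^ 2 = ∑ j, ψ j x ^ 2 * ∑ z, φ j z x ^ 2 := by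
        refine Finset.sum_congr rfl fun j _ => ?_
        rw [Finset.mul_sum]
        exact Finset.sum_congr rfl fun z _ => by rw [prodFam_apply, mul_pow]
    _ = ∑ j, ψ j x ^ 2 := by
        refine Finset.sum_congr rfl fun j _ => ?_
        by_cases hj : ψ j x = 0
        · rw [hj]; ring
        · rw [hφ j hj, mul_one]
    _ = 1 := hψ

/-- `|h_{(j,z)}| ≤ 1` when both factors are `≤ 1` in absolute value. [folklore] -/
theorem abs_prodFam_le_one (ψ : J → X → ℝ) (φ : (j : J) → ι j → X → ℝ) (hψ : ∀ j x, |ψ j x| ≤ 1)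
    (hφ : ∀ j z x, |φ j z x| ≤ 1) (p : Σ j, ι j) (x : X) : |prodFam ψ φ p x| ≤ 1 := by
  obtain ⟨j, z⟩ := p
  rw [prodFam_apply, abs_mul]
  calc |ψ j x| * |φ j z x| ≤ 1 * 1 := mul_le_mul (hψ j x) (hφ j z x) (abs_nonneg _) zero_le_one
    _ = 1 := one_mul _
/-- `h_{(j,z)} ≥ 0` when both factors are. [folklore] -/
theorem prodFam_nonneg (ψ : J → X → ℝ) (φ : (j : J) → ι j → X → ℝ) (hψ : ∀ j x, 0 ≤ ψ j x)
    (hφ : ∀ j z x, 0 ≤ φ j z x) (p : Σ j, ι j) (x : X) : 0 ≤ prodFam ψ φ p x := by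
  obtain ⟨j, z⟩ := p
  exact mul_nonneg (hψ j x) (hφ j z x)

/-- **Supports multiply**: `h_{(j,z)}(x) ≠ 0 ⟹ ψ_j(x) ≠ 0 ∧ φ_{j,z}(x) ≠ 0`. [folklore] -/
theorem prodFam_ne_zero {ψ : J → X → ℝ} {φ : (j : J) → ι j → X → ℝ} {j : J} {z : ι j} {x : X}
    (h : prodFam ψ φ ⟨j, z⟩ x ≠ 0) : ψ j x ≠ 0 ∧ φ j z x ≠ 0 := by
  rw [prodFam_apply] at h
  exact ⟨left_ne_zero_of_mul h, right_ne_zero_of_mul h⟩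

end Family

/-! ## §2 Product rules for first and second differences -/

section Rules

/-- **First-difference product rule**: `|f(y)g(y) − f(x)g(x)| ≤ |f(y)|·|g(y) − g(x)| + |g(x)|·|f(y) − f(x)|`. [folklore] -/
theorem abs_sub_mul_le (fy fx gy gx : ℝ) : |fy * gy - fx * gx| ≤ |fy| * |gy - gx| + |gx| * |fy - fx| := by
  have e : fy * gy - fx * gx = fy * (gy - gx) + gx * (fy - fx) := by ring
  rw [e]
  exact (abs_add_le _ _).trans (by rw [abs_mul, abs_mul])

/-- **Second-difference product rule** along three points `x⁻, x, x⁺`: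
`f⁺g⁺ − 2fg + f⁻g⁻ = f⁺·(g⁺ − 2g + g⁻) + g·(f⁺ − 2f + f⁻) + (g − g⁻)·(f⁺ − f⁻)`. [folklore] -/
theorem secondDiff_mul_eq (fp f fm gp g gm : ℝ) :
    fp * gp - 2 * (f * g) + fm * gm = fp * (gp - 2 * g + gm) + g * (fp - 2 * f + fm) + (g - gm) * (fp - fm) := by
  ring

/-- **Second-difference product bound**: `|f| ≤ F`, `|g| ≤ G` at the relevant points, first differences `|f⁺ − f|, |f − f⁻| ≤ F₁`,
`|g − g⁻| ≤ G₁`, second differences `|δ²f| ≤ F₂`, `|δ²g| ≤ G₂` ⟹ `|δ²(fg)| ≤ F·G₂ + G·F₂ + 2F₁G₁` — scale-adapted factors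
(`F₁, G₁ ≍ 1/(MS)`, `F₂, G₂ ≍ 1/(MS)²`) give a scale-adapted product. [folklore] -/
theorem abs_secondDiff_mul_le {fp f fm gp g gm F G F₁ G₁ F₂ G₂ : ℝ} (hF : |fp| ≤ F) (hG : |g| ≤ G)
    (hF₁p : |fp - f| ≤ F₁) (hF₁m : |f - fm| ≤ F₁) (hG₁ : |g - gm| ≤ G₁) (hF₂ : |fp - 2 * f + fm| ≤ F₂)
    (hG₂ : |gp - 2 * g + gm| ≤ G₂) :
    |fp * gp - 2 * (f * g) + fm * gm| ≤ F * G₂ + G * F₂ + 2 * F₁ * G₁ := by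
  have hF0 : 0 ≤ F := (abs_nonneg _).trans hF
  have hG0 : 0 ≤ G := (abs_nonneg _).trans hG
  have hG₁0 : 0 ≤ G₁ := (abs_nonneg _).trans hG₁
  rw [secondDiff_mul_eq]
  have h1 : |fp * (gp - 2 * g + gm)| ≤ F * G₂ := by
    rw [abs_mul]; exact mul_le_mul hF hG₂ (abs_nonneg _) hF0
  have h2 : |g * (fp - 2 * f + fm)| ≤ G * F₂ := by
    rw [abs_mul]; exact mul_le_mul hG hF₂ (abs_nonneg _) hG0
  have h3 : |(g - gm) * (fp - fm)| ≤ G₁ * (2 * F₁) := by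
    rw [abs_mul]
    refine mul_le_mul hG₁ ?_ (abs_nonneg _) hG₁0
    calc |fp - fm| = |(fp - f) + (f - fm)| := by ring_nf
      _ ≤ |fp - f| + |f - fm| := abs_add_le _ _
      _ ≤ 2 * F₁ := by linarith
  calc |fp * (gp - 2 * g + gm) + g * (fp - 2 * f + fm) + (g - gm) * (fp - fm)|
      ≤ |fp * (gp - 2 * g + gm)| + |g * (fp - 2 * f + fm)| + |(g - gm) * (fp - fm)| :=
        (abs_add_le _ _).trans (add_le_add (abs_add_le _ _) le_rfl)
    _ ≤ F * G₂ + G * F₂ + G₁ * (2 * F₁) := add_le_add (add_le_add h1 h2) h3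
    _ = F * G₂ + G * F₂ + 2 * F₁ * G₁ := by ring

end Rules

/-! ## §3 The family-level packaging -/

section Package

variable {X J : Type} {ι : J → Type}

/-- **FIRST DIFFERENCES OF THE PRODUCT FAMILY**: `|ψ_j| ≤ 1`, `|φ_{j,z}| ≤ 1`, `|ψ_j(y) − ψ_j(x)| ≤ F₁`,
`|φ_{j,z}(y) − φ_{j,z}(x)| ≤ G₁` ⟹ `|h_{(j,z)}(y) − h_{(j,z)}(x)| ≤ G₁ + F₁`. [folklore] -/
theorem abs_prodFam_sub_le (ψ : J → X → ℝ) (φ : (j : J) → ι j → X → ℝ) (hψ : ∀ j x, |ψ j x| ≤ 1)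
    (hφ : ∀ j z x, |φ j z x| ≤ 1) (j : J) (z : ι j) (x y : X) {F₁ G₁ : ℝ} (hF₁ : |ψ j y - ψ j x| ≤ F₁)
    (hG₁ : |φ j z y - φ j z x| ≤ G₁) : |prodFam ψ φ ⟨j, z⟩ y - prodFam ψ φ ⟨j, z⟩ x| ≤ G₁ + F₁ := by
  rw [prodFam_apply, prodFam_apply]
  refine (abs_sub_mul_le _ _ _ _).trans ?_
  have hF0 : 0 ≤ F₁ := (abs_nonneg _).trans hF₁
  have hG0 : 0 ≤ G₁ := (abs_nonneg _).trans hG₁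
  calc |ψ j y| * |φ j z y - φ j z x| + |φ j z x| * |ψ j y - ψ j x| ≤ 1 * G₁ + 1 * F₁ :=
        add_le_add (mul_le_mul (hψ j y) hG₁ (abs_nonneg _) zero_le_one)
          (mul_le_mul (hφ j z x) hF₁ (abs_nonneg _) zero_le_one)
    _ = G₁ + F₁ := by ring

/-- **SECOND DIFFERENCES OF THE PRODUCT FAMILY** along `x⁻, x, x⁺`: factors `≤ 1` in absolute value, first differences of
`ψ_j` `≤ F₁` on both bonds, of `φ_{j,z}` `≤ G₁` on the bond `(x⁻, x)`, second differences `≤ F₂`, `≤ G₂` ⟹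
`|h(x⁺) − 2h(x) + h(x⁻)| ≤ G₂ + F₂ + 2F₁G₁`. [folklore] -/
theorem abs_prodFam_secondDiff_le (ψ : J → X → ℝ) (φ : (j : J) → ι j → X → ℝ) (hψ : ∀ j x, |ψ j x| ≤ 1)
    (hφ : ∀ j z x, |φ j z x| ≤ 1) (j : J) (z : ι j) (xm x xp : X) {F₁ G₁ F₂ G₂ : ℝ}
    (hF₁p : |ψ j xp - ψ j x| ≤ F₁) (hF₁m : |ψ j x - ψ j xm| ≤ F₁) (hG₁ : |φ j z x - φ j z xm| ≤ G₁)
    (hF₂ : |ψ j xp - 2 * ψ j x + ψ j xm| ≤ F₂) (hG₂ : |φ j z xp - 2 * φ j z x + φ j z xm| ≤ G₂) :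
    |prodFam ψ φ ⟨j, z⟩ xp - 2 * prodFam ψ φ ⟨j, z⟩ x + prodFam ψ φ ⟨j, z⟩ xm| ≤ G₂ + F₂ + 2 * F₁ * G₁ := by
  simp only [prodFam_apply]
  have h := abs_secondDiff_mul_le (hψ j xp) (hφ j z x) hF₁p hF₁m hG₁ hF₂ hG₂
  calc |ψ j xp * φ j z xp - 2 * (ψ j x * φ j z x) + ψ j xm * φ j z xm| ≤ 1 * G₂ + 1 * F₂ + 2 * F₁ * G₁ := h
    _ = G₂ + F₂ + 2 * F₁ * G₁ := by ring

end Package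

end

end Summit.QuantumFields.BalabanUV.Beta.MultiscalePartitionProduct
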